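import Literature.Computability.Complexity.TableauStep
import Literature.Computability.Complexity.TautCertificates
import HarnessLib

/-!
# The Cook–Levin tableau formula of a polynomial-time `FinTM2` verifier and its correctness

The propositional heart of the Cook–Levin theorem (Cook 1971, Thm. 1; Levin 1973; Karp 1972,
§4; Sipser 2012, Thm. 7.37; Arora–Barak 2009, Thm. 2.10 / Lemma 2.11) for the machine model of
the H21 classes, Mathlib's multi-stack machines `Turing.FinTM2`. For a bundled machine
`M : TM2ComputableAux Bool Bool` computing a Boolean function `f` (a decider), an input `x`, a
certificate bound `P` and a time bound `T`, we define a **clause set** `clauses M P T x`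
(premise/conclusion clauses over the variables `ℕ × Val M.tm`: "block `b` of the tableau holds
value `v`", blocks being numbered row-major, `b = t · RB + J`), read as the CNF
`tableauCNF M P T x : CNF (ℕ × Val M.tm)` of `CNF.lean` (premises negative, conclusions
positive literals) and as the formula `tableau M P T x = PropForm.ofCNF (tableauCNF …)`,
expressing

  *"the rows `0 … T` are the rows (`Tableau.absVal`, `TableauStep.lean`) of the computation of
  `M` on `⟨x, u⟩ = boolPair x u` for some `u` with `|u| ≤ P`, and the output is `true`"*

(Sipser 2012, proof of Thm. 7.37: cell, start, move and accept clauses; here: exactly-one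
clauses per block, the start row with the doubled bits of `x`, the separator `01`, `P` free
certificate cells followed by empties, the two local rules `Tableau.topF`/`Tableau.intF` of
`TableauStep.lean` tabulated as Horn clauses, empty bottom cells, and the accept clause), and
prove (`satisfiable_tableau_iff`, `satisfiable_tableauCNF_iff`):

  if `M` halts within `T` steps with output `[f w]` on every `w = boolPair x u`, `|u| ≤ P`, then
  `(tableau M P T x).Satisfiable ↔ ∃ u, |u| ≤ P ∧ f (boolPair x u) = true`.

Soundness decodes the rows from a satisfying assignment (exactly-one clauses) and shows by
induction on `t`, using the local rules (`Tableau.absVal_stepTotal_top`/`_int`) and the height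
bound `TM2Sim.length_iterate_stepTotal_le`, that row `t` is the row of the `t`-th configuration
of the run on the decoded certificate; the accept clause and Mathlib's halting configuration
`haltList` then force `f w = true` (the machine being deterministic and total).
Completeness evaluates every clause on the rows of the accepting run.

Only the *clauses depending on the bits of `x`* (`xClauses`, two unit clauses per bit) are
separated from the clauses depending on `|x|` alone (`nClauses`); this is the split used by
the polynomial-time generator of the reduction (`CookLevinReduction.lean`).

## References

* S. A. Cook, *The complexity of theorem-proving procedures*, Proc. 3rd STOC (1971), 151–158,
  Thm. 1.
* M. Sipser, *Introduction to the Theory of Computation*, 3rd ed., Cengage 2012, Thm. 7.37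
  (proof: the formula `φ_cell ∧ φ_start ∧ φ_move ∧ φ_accept`).
* S. Arora, B. Barak, *Computational Complexity: A Modern Approach*, CUP 2009, Thm. 2.10,
  Lemma 2.11 (snapshots and the CNF `φ_x`).
* R. M. Karp, *Reducibility among combinatorial problems* (1972), §4.
-/

namespace Literature.Computability.Complexity

/-! ### Premise/conclusion clauses over an arbitrary variable type -/

/-- A clause over variables `ν`: negative literals (premises) and positive literals
(conclusions); it holds if the premises together imply one of the conclusions.
[Sipser 2012, Thm. 7.37 (proof)] [folklore] -/
abbrev HClause (ν : Type) : Type := List ν × List ν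

namespace HClause

variable {ν : Type}

/-- Truth of a clause under an assignment. [folklore] -/
def Holds (τ : ν → Bool) (cl : HClause ν) : Prop :=
  (∀ v ∈ cl.1, τ v = true) → ∃ v ∈ cl.2, τ v = true

/-- The clause of `CNF.lean` (`Clause ν = List (ν × Bool)`) of a premise/conclusion clause:
premises as negative literals, then conclusions as positive literals.
[Arora–Barak 2009, Def. 2.9] [folklore] -/
def toClause (cl : HClause ν) : Clause ν :=
  cl.1.map (fun v => (v, false)) ++ cl.2.map (fun v => (v, true))

/-- The `CNF.lean` clause of a clause is true exactly when the clause holds. [folklore] -/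
theorem eval_toClause (τ : ν → Bool) (cl : HClause ν) : (toClause cl).eval τ = true ↔ Holds τ cl := by
  unfold toClause Holds Clause.eval
  simp only [List.any_append, Bool.or_eq_true, List.any_eq_true, List.mem_map, Literal.eval]
  constructor
  · rintro (⟨_, ⟨v, hv, rfl⟩, h⟩ | ⟨_, ⟨v, hv, rfl⟩, h⟩)
    · intro hall
      have := hall v hv
      simp_all
    · exact fun _ => ⟨v, hv, by simpa using h⟩
  · intro h
    by_cases hall : ∀ v ∈ cl.1, τ v = true
    · obtain ⟨v, hv, hvt⟩ := h hall
      exact Or.inr ⟨_, ⟨v, hv, rfl⟩, by simpa using hvt⟩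
    · push Not at hall
      obtain ⟨v, hv, hvf⟩ := hall
      exact Or.inl ⟨_, ⟨v, hv, rfl⟩, by simpa using hvf⟩

/-- The CNF (`CNF.lean`) of a clause list. [Sipser 2012, Thm. 7.37 (proof)] [folklore] -/
def cnfOf (cls : List (HClause ν)) : CNF ν :=
  cls.map toClause

/-- The CNF of a clause list is true iff every clause holds. [folklore] -/
theorem eval_cnfOf (τ : ν → Bool) (cls : List (HClause ν)) :
    (cnfOf cls).eval τ = true ↔ ∀ cl ∈ cls, Holds τ cl := by
  rw [cnfOf, CNF.eval_eq_true_iff]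
  simp only [List.forall_mem_map, eval_toClause]

/-- The formula `PropForm.ofCNF` of the CNF of a clause list is true iff every clause holds.
[folklore] -/
theorem eval_ofCNF_cnfOf (τ : ν → Bool) (cls : List (HClause ν)) :
    (PropForm.ofCNF (cnfOf cls)).eval τ = true ↔ ∀ cl ∈ cls, Holds τ cl := by
  rw [PropForm.eval_ofCNF, eval_cnfOf]

/-- A unit clause holds iff its literal is true. [folklore] -/
theorem holds_unit (τ : ν → Bool) (v : ν) : Holds τ ([], [v]) ↔ τ v = true := by
  simp [Holds]

end HClause

/-! ### The tableau clauses of a machine -/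

namespace Tableau

open Turing _root_.Computability

variable (M : TM2ComputableAux Bool Bool)

attribute [local instance] Turing.FinTM2.kFin Turing.FinTM2.ΛFin Turing.FinTM2.σFin
  Turing.FinTM2.Γk₀Fin

/-- The window parameter: one more than the stack-operation depth of the machine. [folklore] -/
noncomputable def dM : ℕ := TM2Sim.depth M.tm + 1

/-- The block value of an input bit: the input symbol of the bit on the input stack.
[Sipser 2012, Thm. 7.37 (proof: start row)] [folklore] -/
noncomputable def symVal (b : Bool) : Val M.tm := (default, inCell (some (M.inputAlphabet.symm b)))

/-- The block value of the initial control. [folklore] -/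
def ctrlVal : Val M.tm := ((some M.tm.main, M.tm.initialState), noneCell M.tm)

/-- The accepting block value: cell `0` of Mathlib's halting configuration with output `[true]`.
[Sipser 2012, Thm. 7.37 (proof: accept)] [folklore] -/
noncomputable def accVal : Val M.tm := (default, outCell (some (M.outputAlphabet.symm true)))

/-- The list of all block values (for the exactly-one clauses and the tabulated rules). [folklore] -/
noncomputable def allVals : List (Val M.tm) :=
  haveI := Fintype.ofFinite (Val M.tm); Finset.univ.toList

/-- Every block value is listed. [folklore] -/
theorem mem_allVals (v : Val M.tm) : v ∈ allVals M := by
  unfold allVals; simp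

/-- The list of all tuples of block values of a given length. [folklore] -/
noncomputable def allTuples (m : ℕ) : List (Fin m → Val M.tm) :=
  haveI := Fintype.ofFinite (Val M.tm); Finset.univ.toList

/-- Every tuple is listed. [folklore] -/
theorem mem_allTuples {m : ℕ} (a : Fin m → Val M.tm) : a ∈ allTuples M m := by
  unfold allTuples; simp

section Params

variable (n P T : ℕ)

/-- Input length of the verifier: `|boolPair x u| ≤ 2n + 2 + P`. [folklore] -/
def NN : ℕ := 2 * n + 2 + P

/-- Index of the last block of a row: `S₁ = N + d T + 3 d` (cells `0 … S₁ - 1`; the stacks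
never grow beyond `N + d T`). [Sipser 2012, Thm. 7.37 (proof: an `nᵏ × nᵏ` tableau)] [folklore] -/
noncomputable def S1 : ℕ := NN n P + dM M * T + 3 * dM M

/-- Row width in blocks: `RB = S₁ + 1`. [folklore] -/
noncomputable def RB : ℕ := S1 M n P T + 1

/-- The absolute number of block `J` of row `t` (row-major). [folklore] -/
noncomputable def blk (t J : ℕ) : ℕ := t * RB M n P T + J

end Params

/-- Tableau variables: "block `b` holds value `v`". [Sipser 2012, Thm. 7.37 (proof: `x_{i,j,s}`)] [folklore] -/
abbrev TVar : Type := ℕ × Val M.tm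

section Clauses

variable (n P T : ℕ)

local notation "d" => dM M
local notation "β" => blk M n P T

/-- The two unit clauses of input bit `b` at position `i`: blocks `2i + 1`, `2i + 2` of row `0`
hold the doubled bit. [Sipser 2012, Thm. 7.37 (proof: `φ_start`)] [folklore] -/
noncomputable def bitClauses (b : Bool) (i : ℕ) : List (HClause (TVar M)) :=
  [([], [(β 0 (2 * i + 1), symVal M b)]), ([], [(β 0 (2 * i + 2), symVal M b)])]

/-- The clauses depending on the bits of `x`. [Sipser 2012, Thm. 7.37 (proof: `φ_start`)] [folklore] -/
noncomputable def xClauses (x : List Bool) : List (HClause (TVar M)) :=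
  x.zipIdx.flatMap fun p => bitClauses M n P T p.1 p.2

/-- Start-row clauses depending on `n` only: the initial control, the separator `01` after the
doubled bits, `P` free certificate cells (an input symbol or empty; once empty, empty), and
empty cells down to the last block. [Sipser 2012, Thm. 7.37 (proof: `φ_start`)] [folklore] -/
noncomputable def startClauses : List (HClause (TVar M)) :=
  [([], [(β 0 0, ctrlVal M)]), ([], [(β 0 (2 * n + 1), symVal M false)]),
    ([], [(β 0 (2 * n + 2), symVal M true)])] ++
  ((List.range P).flatMap fun j =>
    [([], [(β 0 (2 * n + 3 + j), symVal M false), (β 0 (2 * n + 3 + j), symVal M true),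
        (β 0 (2 * n + 3 + j), noneVal M.tm)]),
     ([(β 0 (2 * n + 3 + j), noneVal M.tm)], [(β 0 (2 * n + 4 + j), noneVal M.tm)])]) ++
  ((List.range (d * T + 3 * d)).map fun j => ([], [(β 0 (NN n P + 1 + j), noneVal M.tm)]))

/-- Move clauses of row `t`, top part: the rule `topF` tabulated — for every tuple `a` of values of
blocks `0 … 3d` of row `t` and every `r ≤ 2d`, "blocks `= a` ⟹ block `r` of row `t + 1` is
`topF d a r`". [Sipser 2012, Thm. 7.37 (proof: `φ_move`, legal windows)] [folklore] -/
noncomputable def topClauses (t : ℕ) : List (HClause (TVar M)) :=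
  (allTuples M (3 * d + 1)).flatMap fun a =>
    (List.finRange (2 * d + 1)).map fun (r : Fin (2 * d + 1)) =>
      ((List.finRange (3 * d + 1)).map fun (s : Fin (3 * d + 1)) => (β t s, a s),
        [(β (t + 1) r, topF d a r)])

/-- Move clauses of row `t`, interior block `J = 2d + 1 + j`: the rule `intF` tabulated over the
head blocks `0 … d` and the neighbourhood blocks `J - d … J + d` of row `t`.
[Sipser 2012, Thm. 7.37 (proof: `φ_move`)] [folklore] -/
noncomputable def intClauses (t j : ℕ) : List (HClause (TVar M)) :=
  (allTuples M (d + 1)).flatMap fun h => (allTuples M (2 * d + 1)).map fun nb =>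
    (((List.finRange (d + 1)).map fun (s : Fin (d + 1)) => (β t s, h s)) ++
      ((List.finRange (2 * d + 1)).map fun (s : Fin (2 * d + 1)) => (β t (d + 1 + j + s), nb s)),
     [(β (t + 1) (2 * d + 1 + j), intF d h nb)])

/-- Bottom clauses of row `t + 1`: the last `d` blocks are empty.
[Sipser 2012, Thm. 7.37 (proof)] [folklore] -/
noncomputable def botClauses (t : ℕ) : List (HClause (TVar M)) :=
  (List.range d).map fun r => ([], [(β (t + 1) (NN n P + d * T + 2 * d + 1 + r), noneVal M.tm)])

open scoped Classical in
/-- Exactly-one clauses of block `J` of row `t`. [Sipser 2012, Thm. 7.37 (proof: `φ_cell`)] [folklore] -/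
noncomputable def cellClauses (t J : ℕ) : List (HClause (TVar M)) :=
  ([], (allVals M).map fun v => (β t J, v)) ::
    ((allVals M).flatMap fun v => (allVals M).flatMap fun v' =>
      if v = v' then [] else [([(β t J, v), (β t J, v')], [])])

/-- All clauses depending on `n = |x|` only, in the order in which the generator emits them:
start, then for every `t < T` the move clauses (top, interior, bottom), then the exactly-one
clauses of all blocks of all rows, then accept. [Sipser 2012, Thm. 7.37 (proof)] [folklore] -/
noncomputable def nClauses : List (HClause (TVar M)) :=
  startClauses M n P T ++
  ((List.range T).flatMap fun t =>
    topClauses M n P T t ++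
    ((List.range (NN n P + d * T)).flatMap fun j => intClauses M n P T t j) ++
    botClauses M n P T t) ++
  ((List.range (T + 1)).flatMap fun t => (List.range (S1 M n P T + 1)).flatMap fun J =>
    cellClauses M n P T t J) ++
  [([], [(β T 1, accVal M)])]

/-- **The Cook–Levin clause set** of `M` on input `x` with certificate bound `P` and time bound
`T`. [cite: Cook1971, Thm. 1] [cite: Sipser2012, Thm. 7.37 (proof)] -/
noncomputable def clauses (x : List Bool) : List (HClause (TVar M)) :=
  xClauses M x.length P T x ++ nClauses M x.length P T

/-- **The Cook–Levin CNF** of `M` on `x` (bounds `P`, `T`): the clause set as a `CNF` of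
`CNF.lean` over the block variables. [cite: Cook1971, Thm. 1] [cite: Sipser2012, Thm. 7.37] -/
noncomputable def tableauCNF (x : List Bool) : CNF (TVar M) :=
  HClause.cnfOf (clauses M P T x)

/-- **The Cook–Levin tableau formula**: `PropForm.ofCNF` of the Cook–Levin CNF.
[cite: Cook1971, Thm. 1] [cite: Sipser2012, Thm. 7.37] -/
noncomputable def tableau (x : List Bool) : PropForm (TVar M) :=
  PropForm.ofCNF (tableauCNF M P T x)

end Clauses

/-! ### The run on a certificate -/

/-- The machine input on certificate `u`: `boolPair x u` in the input alphabet. [folklore] -/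
def inp (x u : List Bool) : List (M.tm.Γ M.tm.k₀) := (boolPair x u).map M.inputAlphabet.symm

/-- The `t`-th configuration of the run on certificate `u` (total step function, so the run
idles after halting). [Sipser 2012, Thm. 7.37 (proof: row `t` of the tableau)] [folklore] -/
noncomputable def cfgAt (x u : List Bool) (t : ℕ) : M.tm.Cfg :=
  (TM2Sim.stepTotal M.tm)^[t] (initList M.tm (inp M x u))

variable {M}

/-- The run consists of good configurations. [folklore] -/
theorem good_cfgAt (x u : List Bool) (t : ℕ) : TM2Sim.Good M.tm (cfgAt M x u t) :=
  TM2Sim.Good.iterate M.tm (TM2Sim.good_initList M.tm _) t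

/-- Height bound along the run: `|stack| ≤ |boolPair x u| + depth · t`. [folklore] -/
theorem length_cfgAt_le (x u : List Bool) (t : ℕ) (k : M.tm.K) :
    ((cfgAt M x u t).stk k).length ≤ 2 * x.length + 2 + u.length + TM2Sim.depth M.tm * t := by
  have h1 := TM2Sim.length_iterate_stepTotal_le M.tm (initList M.tm (inp M x u)) k t
  have h2 := FinTM2Sim.length_initList_le (tm := M.tm) (inp M x u) k
  have h3 : (inp M x u).length = 2 * x.length + 2 + u.length := by simp [inp]
  unfold cfgAt
  omega

/-- The next configuration of the run. [folklore] -/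
theorem cfgAt_succ (x u : List Bool) (t : ℕ) :
    cfgAt M x u (t + 1) = TM2Sim.stepTotal M.tm (cfgAt M x u t) := by
  unfold cfgAt; rw [Function.iterate_succ_apply']

/-- If the machine halts with output `[b]` within `T` steps, configuration `T` of the run is
Mathlib's halting configuration with output `[b]`. [folklore] -/
theorem cfgAt_eq_haltList {x u : List Bool} {b : Bool} {T : ℕ}
    (h : M.OutputsWithin (boolPair x u) [b] T) :
    cfgAt M x u T = haltList M.tm [M.outputAlphabet.symm b] := by
  have := TM2Sim.iterate_stepTotal_of_outputsWithin M h
  simpa [cfgAt, inp] using this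

/-! ### The start row -/

/-- Even positions of the doubled word. [folklore] -/
theorem getElem?_flatMap_dup_even (x : List Bool) (i : ℕ) :
    (x.flatMap fun b => [b, b])[2 * i]? = x[i]? := by
  induction x generalizing i with
  | nil => simp
  | cons b x ih =>
    cases i with
    | zero => simp
    | succ i =>
      rw [List.flatMap_cons, List.getElem?_append_right (by simp)]
      simp only [List.length_cons, List.length_nil]
      rw [show 2 * (i + 1) - (0 + 1 + 1) = 2 * i by omega, ih]; simp

/-- Odd positions of the doubled word. [folklore] -/
theorem getElem?_flatMap_dup_odd (x : List Bool) (i : ℕ) :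
    (x.flatMap fun b => [b, b])[2 * i + 1]? = x[i]? := by
  induction x generalizing i with
  | nil => simp
  | cons b x ih =>
    cases i with
    | zero => simp
    | succ i =>
      rw [List.flatMap_cons, List.getElem?_append_right (by simp; omega)]
      simp only [List.length_cons, List.length_nil]
      rw [show 2 * (i + 1) + 1 - (0 + 1 + 1) = 2 * i + 1 by omega, ih]; simp

/-- Length of the doubled word (`SProg.length_dbl` of `StackMachines.lean`, restated for the
unfolded `flatMap`). [folklore] -/
theorem length_flatMap_dup (x : List Bool) : (x.flatMap fun b => [b, b]).length = 2 * x.length :=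
  SProg.length_dbl x

/-- The doubled bits inside `boolPair x u`. [folklore] -/
theorem getElem?_boolPair_bit {x : List Bool} (u : List Bool) {i : ℕ} {b : Bool}
    (h : x[i]? = some b) :
    (boolPair x u)[2 * i + 1 - 1]? = some b ∧ (boolPair x u)[2 * i + 2 - 1]? = some b := by
  have hi : i < x.length := by
    by_contra hle; rw [List.getElem?_eq_none (by omega)] at h; cases h
  simp only [boolPair, List.append_assoc]
  rw [List.getElem?_append_left (by rw [length_flatMap_dup]; omega),
    List.getElem?_append_left (by rw [length_flatMap_dup]; omega),
    show 2 * i + 1 - 1 = 2 * i by omega, show 2 * i + 2 - 1 = 2 * i + 1 by omega,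
    getElem?_flatMap_dup_even, getElem?_flatMap_dup_odd, h]
  exact ⟨rfl, rfl⟩

/-- The separator and the certificate inside `boolPair x u`. [folklore] -/
theorem getElem?_boolPair_add (x u : List Bool) (j : ℕ) :
    (boolPair x u)[2 * x.length + j]? = ([false, true] ++ u)[j]? := by
  simp only [boolPair, List.append_assoc]
  rw [List.getElem?_append_right (by rw [length_flatMap_dup]; omega), length_flatMap_dup,
    Nat.add_sub_cancel_left]

/-- Block `0` of the start row is the initial control. [folklore] -/
theorem absVal_cfgAt_zero_zero (x u : List Bool) : absVal (cfgAt M x u 0) 0 = ctrlVal M := by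
  show absVal (initList M.tm (inp M x u)) 0 = _
  rw [absVal_initList_zero]; rfl

/-- Block `i + 1` of the start row holds input symbol `i`. [folklore] -/
theorem absVal_cfgAt_zero_succ (x u : List Bool) (i : ℕ) :
    absVal (cfgAt M x u 0) (i + 1) =
      (default, inCell (((boolPair x u)[i]?).map M.inputAlphabet.symm)) := by
  show absVal (initList M.tm (inp M x u)) (i + 1) = _
  rw [absVal_initList_succ, inp, List.getElem?_map]

/-- The empty block is the block of an absent input symbol. [folklore] -/
theorem noneVal_eq : noneVal M.tm = (default, inCell (tm := M.tm) none) := by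
  rw [inCell_none]; rfl

/-- Blocks `2i + 1`, `2i + 2` of the start row hold the doubled bit `xᵢ`. [folklore] -/
theorem absVal_cfgAt_zero_bit {x : List Bool} (u : List Bool) {i : ℕ} {b : Bool}
    (h : x[i]? = some b) :
    absVal (cfgAt M x u 0) (2 * i + 1) = symVal M b ∧ absVal (cfgAt M x u 0) (2 * i + 2) = symVal M b := by
  obtain ⟨h1, h2⟩ := getElem?_boolPair_bit u h
  constructor
  · rw [show 2 * i + 1 = (2 * i + 1 - 1) + 1 by omega, absVal_cfgAt_zero_succ, h1]; rfl
  · rw [show 2 * i + 2 = (2 * i + 2 - 1) + 1 by omega, absVal_cfgAt_zero_succ, h2]; rfl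

/-- Blocks `2n + 1`, `2n + 2` of the start row hold the separator `01`. [folklore] -/
theorem absVal_cfgAt_zero_sep (x u : List Bool) :
    absVal (cfgAt M x u 0) (2 * x.length + 1) = symVal M false ∧
      absVal (cfgAt M x u 0) (2 * x.length + 2) = symVal M true := by
  constructor
  · rw [absVal_cfgAt_zero_succ, show 2 * x.length = 2 * x.length + 0 from rfl,
      getElem?_boolPair_add]; rfl
  · rw [show 2 * x.length + 2 = (2 * x.length + 1) + 1 by omega, absVal_cfgAt_zero_succ,
      getElem?_boolPair_add]; rfl

/-- Block `2n + 3 + j` of the start row holds certificate bit `j` (empty beyond the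
certificate). [folklore] -/
theorem absVal_cfgAt_zero_cert (x u : List Bool) (j : ℕ) :
    absVal (cfgAt M x u 0) (2 * x.length + 3 + j) =
      (default, inCell ((u[j]?).map M.inputAlphabet.symm)) := by
  rw [show 2 * x.length + 3 + j = (2 * x.length + (2 + j)) + 1 by omega, absVal_cfgAt_zero_succ,
    getElem?_boolPair_add, show 2 + j = (j + 1) + 1 by omega]
  rfl

/-- Certificate blocks: an input symbol or empty. [folklore] -/
theorem absVal_cfgAt_zero_cert_cases (x u : List Bool) (j : ℕ) :
    (∃ b, u[j]? = some b ∧ absVal (cfgAt M x u 0) (2 * x.length + 3 + j) = symVal M b) ∨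
      (u.length ≤ j ∧ absVal (cfgAt M x u 0) (2 * x.length + 3 + j) = noneVal M.tm) := by
  rw [absVal_cfgAt_zero_cert]
  cases h : u[j]? with
  | none =>
    right
    exact ⟨by simpa using h, by rw [noneVal_eq]; rfl⟩
  | some b => left; exact ⟨b, rfl, rfl⟩

/-- `symVal b` is never the empty block. [folklore] -/
theorem symVal_ne_noneVal (b : Bool) : symVal M b ≠ noneVal M.tm := by
  rw [noneVal_eq]
  intro h
  have := inCell_injective (congrArg Prod.snd h)
  cases this

/-- `symVal` is injective. [folklore] -/
theorem symVal_injective : Function.Injective (symVal M) := by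
  intro b b' h
  have := inCell_injective (congrArg Prod.snd h)
  simpa using this

/-! ### Arithmetic of block numbers -/

section Arith

variable (M) (n P T : ℕ)

/-- Rows have positive width. [folklore] -/
theorem RB_pos : 0 < RB M n P T := Nat.succ_pos _

/-- The row of a block number. [folklore] -/
theorem blk_div {t J : ℕ} (hJ : J ≤ S1 M n P T) : blk M n P T t J / RB M n P T = t := by
  unfold blk
  rw [Nat.mul_comm, Nat.mul_add_div (RB_pos M n P T), Nat.div_eq_of_lt (by unfold RB; omega),
    Nat.add_zero]

/-- The column of a block number. [folklore] -/
theorem blk_mod {t J : ℕ} (hJ : J ≤ S1 M n P T) : blk M n P T t J % RB M n P T = J := by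
  unfold blk
  rw [Nat.mul_comm, Nat.mul_add_mod, Nat.mod_eq_of_lt (by unfold RB; omega)]

/-- Block numbers are injective on the tableau. [folklore] -/
theorem blk_inj {t t' J J' : ℕ} (hJ : J ≤ S1 M n P T) (hJ' : J' ≤ S1 M n P T)
    (h : blk M n P T t J = blk M n P T t' J') : t = t' ∧ J = J' := by
  constructor
  · rw [← blk_div M n P T (t := t) hJ, h, blk_div M n P T hJ']
  · rw [← blk_mod M n P T (t := t) hJ, h, blk_mod M n P T hJ']

/-- Unfolding of `S1`. [folklore] -/
theorem S1_eq : S1 M n P T = NN n P + dM M * T + 3 * dM M := rfl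

/-- Unfolding of `NN`. [folklore] -/
theorem NN_eq : NN n P = 2 * n + 2 + P := rfl

/-- The window parameter exceeds the depth. [folklore] -/
theorem depth_lt_dM : TM2Sim.depth M.tm < dM M := Nat.lt_succ_self _

end Arith

/-! ### Membership of the clause families in the clause set -/

section Mem

variable (x : List Bool) (P T : ℕ)

local notation "n" => x.length
local notation "d" => dM M
local notation "CL" => clauses M P T x

/-- The bit clauses of a bit of `x` belong to the clause set. [folklore] -/
theorem mem_clauses_bit {i : ℕ} {b : Bool} (h : x[i]? = some b) {cl : HClause (TVar M)}
    (hcl : cl ∈ bitClauses M n P T b i) : cl ∈ CL := by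
  unfold clauses xClauses
  refine List.mem_append_left _ (List.mem_flatMap.2 ⟨(b, i), ?_, hcl⟩)
  exact List.mk_mem_zipIdx_iff_getElem?.2 h

/-- The start clauses belong to the clause set. [folklore] -/
theorem mem_clauses_start {cl : HClause (TVar M)} (hcl : cl ∈ startClauses M n P T) : cl ∈ CL := by
  unfold clauses nClauses
  exact List.mem_append_right _ (List.mem_append_left _
    (List.mem_append_left _ (List.mem_append_left _ hcl)))

/-- The move clauses of a row `t < T` belong to the clause set. [folklore] -/
theorem mem_clauses_move {t : ℕ} (ht : t < T) {cl : HClause (TVar M)}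
    (hcl : cl ∈ topClauses M n P T t ++
      ((List.range (NN n P + d * T)).flatMap fun j => intClauses M n P T t j) ++
      botClauses M n P T t) : cl ∈ CL := by
  unfold clauses nClauses
  refine List.mem_append_right _ (List.mem_append_left _
    (List.mem_append_left _ (List.mem_append_right _ ?_)))
  exact List.mem_flatMap.2 ⟨t, List.mem_range.2 ht, hcl⟩

/-- The top clauses of a row `t < T` belong to the clause set. [folklore] -/
theorem mem_clauses_top {t : ℕ} (ht : t < T) {cl : HClause (TVar M)}
    (hcl : cl ∈ topClauses M n P T t) : cl ∈ CL :=
  mem_clauses_move x P T ht (List.mem_append_left _ (List.mem_append_left _ hcl))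

/-- The interior clauses of a row `t < T` belong to the clause set. [folklore] -/
theorem mem_clauses_int {t j : ℕ} (ht : t < T) (hj : j < NN n P + d * T) {cl : HClause (TVar M)}
    (hcl : cl ∈ intClauses M n P T t j) : cl ∈ CL :=
  mem_clauses_move x P T ht (List.mem_append_left _ (List.mem_append_right _
    (List.mem_flatMap.2 ⟨j, List.mem_range.2 hj, hcl⟩)))

/-- The bottom clauses of a row `t < T` belong to the clause set. [folklore] -/
theorem mem_clauses_bot {t : ℕ} (ht : t < T) {cl : HClause (TVar M)}
    (hcl : cl ∈ botClauses M n P T t) : cl ∈ CL :=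
  mem_clauses_move x P T ht (List.mem_append_right _ hcl)

/-- The exactly-one clauses of a tableau block belong to the clause set. [folklore] -/
theorem mem_clauses_cell {t J : ℕ} (ht : t ≤ T) (hJ : J ≤ S1 M n P T) {cl : HClause (TVar M)}
    (hcl : cl ∈ cellClauses M n P T t J) : cl ∈ CL := by
  unfold clauses nClauses
  refine List.mem_append_right _ (List.mem_append_left _ (List.mem_append_right _ ?_))
  exact List.mem_flatMap.2 ⟨t, List.mem_range.2 (by omega),
    List.mem_flatMap.2 ⟨J, List.mem_range.2 (by omega), hcl⟩⟩

/-- The accept clause belongs to the clause set. [folklore] -/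
theorem mem_clauses_acc : ([], [(blk M n P T T 1, accVal M)]) ∈ CL := by
  unfold clauses nClauses
  exact List.mem_append_right _ (List.mem_append_right _ (List.mem_singleton.2 rfl))

end Mem

/-! ### Soundness: decoding the rows of a satisfying assignment -/

section Sound

variable {x : List Bool} {P T : ℕ} {τ : TVar M → Bool}
  (hτ : ∀ cl ∈ clauses M P T x, HClause.Holds τ cl)

local notation "n" => x.length
local notation "d" => dM M
local notation "β" => blk M (List.length x) P T
local notation "SS" => S1 M (List.length x) P T

include hτ

/-- A unit clause of the clause set makes its literal true. [folklore] -/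
theorem true_of_unit {v : TVar M} (h : ([], [v]) ∈ clauses M P T x) : τ v = true :=
  (HClause.holds_unit τ v).1 (hτ _ h)

/-- Exactly one value per block (the cell clauses). [Sipser 2012, Thm. 7.37 (proof: `φ_cell`)] [folklore] -/
theorem existsUnique_val {t J : ℕ} (ht : t ≤ T) (hJ : J ≤ SS) : ∃! v, τ (β t J, v) = true := by
  have h1 := hτ _ (mem_clauses_cell x P T ht hJ (List.mem_cons_self ..))
  obtain ⟨w, hw, hwt⟩ := h1 (by simp)
  obtain ⟨v, -, rfl⟩ := List.mem_map.1 hw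
  refine ⟨v, hwt, fun v' hv' => ?_⟩
  by_contra hne
  have hmem : ([(β t J, v'), (β t J, v)], []) ∈ cellClauses M n P T t J := by
    refine List.mem_cons_of_mem _ (List.mem_flatMap.2 ⟨v', mem_allVals M v', List.mem_flatMap.2
      ⟨v, mem_allVals M v, ?_⟩⟩)
    rw [if_neg hne]; exact List.mem_singleton.2 rfl
  obtain ⟨w, hw, -⟩ := hτ _ (mem_clauses_cell x P T ht hJ hmem) (by simp [hv', hwt])
  simp at hw

/-- The decoded value of block `J` of row `t`. [folklore] -/
noncomputable def dec (τ : TVar M → Bool) (x : List Bool) (P T t J : ℕ) : Val M.tm :=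
  by classical exact if h : ∃ v, τ (blk M x.length P T t J, v) = true then h.choose else default

omit hτ in
/-- Specification of the decoded value. [folklore] -/
theorem dec_spec_aux {t J : ℕ} (h : ∃! v, τ (β t J, v) = true) (v : Val M.tm) :
    τ (β t J, v) = true ↔ dec τ x P T t J = v := by
  classical
  have hex : ∃ v, τ (β t J, v) = true := h.exists
  have hd : dec τ x P T t J = hex.choose := dif_pos hex
  have hc : τ (β t J, hex.choose) = true := hex.choose_spec
  rw [hd]
  exact ⟨fun hv => h.unique hc hv, fun e => e ▸ hc⟩

/-- In the tableau, a block variable is true iff its value is the decoded value. [folklore] -/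
theorem dec_spec {t J : ℕ} (ht : t ≤ T) (hJ : J ≤ SS) (v : Val M.tm) :
    τ (β t J, v) = true ↔ dec τ x P T t J = v :=
  dec_spec_aux (existsUnique_val hτ ht hJ) v

/-- The decoded block variable is true. [folklore] -/
theorem dec_true {t J : ℕ} (ht : t ≤ T) (hJ : J ≤ SS) : τ (β t J, dec τ x P T t J) = true :=
  (dec_spec hτ ht hJ _).2 rfl

/-- **Decoding the start row**: some certificate `u`, `|u| ≤ P`, has the decoded row `0` as the
row of its initial configuration (Sipser 2012, proof of Thm. 7.37, `φ_start`).
[cite: Sipser2012, Thm. 7.37 (proof)] -/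
theorem dec_zero : ∃ u : List Bool, u.length ≤ P ∧
    ∀ J ≤ SS, dec τ x P T 0 J = absVal (cfgAt M x u 0) J := by
  classical
  have hS : SS = 2 * n + 2 + P + d * T + 3 * d := rfl
  have hT0 : 0 ≤ T := Nat.zero_le _
  have hd1 : 1 ≤ d := by have := depth_lt_dM M; omega
  -- the certificate blocks
  let g : ℕ → Val M.tm := fun j => dec τ x P T 0 (2 * n + 3 + j)
  obtain ⟨m, hmP, hlt, hmspec⟩ : ∃ m, m ≤ P ∧ (∀ j < m, g j ≠ noneVal M.tm) ∧
      (m = P ∨ g m = noneVal M.tm) := by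
    have hex : ∃ m, m = P ∨ g m = noneVal M.tm := ⟨P, Or.inl rfl⟩
    exact ⟨Nat.find hex, Nat.find_min' hex (Or.inl rfl),
      fun j hj hn => Nat.find_min hex hj (Or.inr hn), Nat.find_spec hex⟩
  have hfree : ∀ j < P, g j = symVal M false ∨ g j = symVal M true ∨ g j = noneVal M.tm := by
    intro j hj
    have hmem : ([], [(β 0 (2 * n + 3 + j), symVal M false), (β 0 (2 * n + 3 + j), symVal M true),
        (β 0 (2 * n + 3 + j), noneVal M.tm)]) ∈ startClauses M n P T := by
      refine List.mem_append_left _ (List.mem_append_right _ (List.mem_flatMap.2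
        ⟨j, List.mem_range.2 hj, ?_⟩))
      simp
    obtain ⟨w, hw, hwt⟩ := hτ _ (mem_clauses_start x P T hmem) (by simp)
    have hJ : 2 * n + 3 + j ≤ SS := by omega
    simp only [List.mem_cons, List.mem_nil_iff, or_false] at hw
    rcases hw with rfl | rfl | rfl
    · exact Or.inl ((dec_spec hτ hT0 hJ _).1 hwt)
    · exact Or.inr (Or.inl ((dec_spec hτ hT0 hJ _).1 hwt))
    · exact Or.inr (Or.inr ((dec_spec hτ hT0 hJ _).1 hwt))
  have hchain : ∀ j < P, g j = noneVal M.tm → g (j + 1) = noneVal M.tm := by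
    intro j hj hg
    have hmem : ([(β 0 (2 * n + 3 + j), noneVal M.tm)], [(β 0 (2 * n + 4 + j), noneVal M.tm)]) ∈
        startClauses M n P T := by
      refine List.mem_append_left _ (List.mem_append_right _ (List.mem_flatMap.2
        ⟨j, List.mem_range.2 hj, ?_⟩))
      simp
    have h1 := hτ _ (mem_clauses_start x P T hmem)
      (by simpa using (dec_spec hτ hT0 (by omega) _).2 hg)
    obtain ⟨w, hw, hwt⟩ := h1
    simp only [List.mem_cons, List.mem_nil_iff, or_false] at hw
    subst hw
    have := (dec_spec hτ hT0 (by omega : 2 * n + 4 + j ≤ SS) _).1 hwt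
    simpa [g, show 2 * n + 3 + (j + 1) = 2 * n + 4 + j by omega] using this
  have hge : ∀ j, m ≤ j → j < P → g j = noneVal M.tm := by
    intro j hmj hjP
    induction j with
    | zero =>
      have hm0 : m = 0 := by omega
      rcases hmspec with h | h
      · omega
      · rw [hm0] at h; exact h
    | succ j ih =>
      rcases Nat.eq_or_lt_of_le hmj with h | h
      · rcases hmspec with h' | h'
        · omega
        · rw [h] at h'; exact h'
      · exact hchain j (by omega) (ih (by omega) (by omega))
  -- the certificate
  let u : List Bool := (List.range m).map fun j => decide (g j = symVal M true)
  have hu : u.length = m := by simp [u]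
  have hgu : ∀ (j : ℕ) (hj : j < m), g j = symVal M (u[j]'(by rw [hu]; exact hj)) := by
    intro j hj
    have hval : u[j]'(by rw [hu]; exact hj) = decide (g j = symVal M true) := by simp [u]
    rw [hval]
    rcases hfree j (by omega) with h | h | h
    · rw [h, decide_eq_false (fun e => Bool.false_ne_true (symVal_injective e))]
    · rw [h, decide_eq_true rfl]
    · exact absurd h (hlt j hj)
  refine ⟨u, hu ▸ hmP, fun J hJ => ?_⟩
  -- block by block
  rcases Nat.eq_zero_or_pos J with rfl | hJpos
  · rw [absVal_cfgAt_zero_zero]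
    exact (dec_spec hτ hT0 hJ _).1 (true_of_unit hτ (mem_clauses_start x P T (by simp [startClauses])))
  by_cases hJx : J ≤ 2 * n
  · -- a doubled bit of `x`
    obtain ⟨i, hi, hJi⟩ : ∃ i, i < n ∧ (J = 2 * i + 1 ∨ J = 2 * i + 2) :=
      ⟨(J - 1) / 2, by omega, by omega⟩
    obtain ⟨b, hb⟩ : ∃ b, x[i]? = some b := ⟨x[i], List.getElem?_eq_getElem hi⟩
    obtain ⟨h1, h2⟩ := absVal_cfgAt_zero_bit (M := M) u hb
    rcases hJi with rfl | rfl
    · rw [h1]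
      exact (dec_spec hτ hT0 hJ _).1 (true_of_unit hτ
        (mem_clauses_bit x P T hb (by simp [bitClauses])))
    · rw [h2]
      exact (dec_spec hτ hT0 hJ _).1 (true_of_unit hτ
        (mem_clauses_bit x P T hb (by simp [bitClauses])))
  by_cases hJs : J ≤ 2 * n + 2
  · -- the separator
    obtain ⟨h1, h2⟩ := absVal_cfgAt_zero_sep (M := M) x u
    rcases (show J = 2 * n + 1 ∨ J = 2 * n + 2 by omega) with rfl | rfl
    · rw [h1]
      exact (dec_spec hτ hT0 hJ _).1 (true_of_unit hτ (mem_clauses_start x P T (by simp [startClauses])))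
    · rw [h2]
      exact (dec_spec hτ hT0 hJ _).1 (true_of_unit hτ (mem_clauses_start x P T (by simp [startClauses])))
  -- certificate or empty
  obtain ⟨j, rfl⟩ : ∃ j, J = 2 * n + 3 + j := ⟨J - (2 * n + 3), by omega⟩
  change g j = _
  by_cases hjm : j < m
  · rw [hgu j hjm]
    obtain ⟨b, hb⟩ : ∃ b, u[j]? = some b := ⟨_, List.getElem?_eq_getElem (by rw [hu]; exact hjm)⟩
    rcases absVal_cfgAt_zero_cert_cases (M := M) x u j with ⟨b', hb', h'⟩ | ⟨hlen, -⟩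
    · rw [h', (List.getElem_eq_iff _).2 hb']
    · omega
  · rcases absVal_cfgAt_zero_cert_cases (M := M) x u j with ⟨b', hb', -⟩ | ⟨-, h'⟩
    · have : j < u.length := by
        by_contra hle; rw [List.getElem?_eq_none (by omega)] at hb'; cases hb'
      omega
    rw [h']
    by_cases hjP : j < P
    · exact hge j (by omega) hjP
    · -- the empty tail
      obtain ⟨r, rfl⟩ : ∃ r, j = P + r := ⟨j - P, by omega⟩
      have hr : r < d * T + 3 * d := by omega
      have hmem : ([], [(β 0 (NN n P + 1 + r), noneVal M.tm)]) ∈ startClauses M n P T :=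
        List.mem_append_right _ (List.mem_map.2 ⟨r, List.mem_range.2 hr, rfl⟩)
      have := true_of_unit hτ (mem_clauses_start x P T hmem)
      rw [show NN n P + 1 + r = 2 * n + 3 + (P + r) by rw [NN_eq]; omega] at this
      exact (dec_spec hτ hT0 hJ _).1 this

/-- **Decoding a step**: if the decoded row `t < T` is the row of a good configuration `c` of
height `≤ N + depth · t`... stated for the run: row `t + 1` is the row of the next configuration
(Sipser 2012, proof of Thm. 7.37, `φ_move`; the local rules of `TableauStep.lean`).
[cite: Sipser2012, Thm. 7.37 (proof)] -/
theorem dec_succ {u : List Bool} (hu : u.length ≤ P) {t : ℕ} (ht : t < T)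
    (hrow : ∀ J ≤ SS, dec τ x P T t J = absVal (cfgAt M x u t) J) :
    ∀ J ≤ SS, dec τ x P T (t + 1) J = absVal (cfgAt M x u (t + 1)) J := by
  have hS : SS = 2 * n + 2 + P + d * T + 3 * d := rfl
  have hd : TM2Sim.depth M.tm ≤ d := (depth_lt_dM M).le
  have hd1 : 1 ≤ d := by have := depth_lt_dM M; omega
  have hgood := good_cfgAt (M := M) x u t
  intro J hJ
  rw [← dec_spec hτ ht hJ, cfgAt_succ]
  by_cases hJtop : J ≤ 2 * d
  · -- top rule
    let a : Fin (3 * d + 1) → Val M.tm := fun s => absVal (cfgAt M x u t) s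
    have hval := absVal_stepTotal_top hd (cfgAt M x u t) hgood ⟨J, by omega⟩
    simp only at hval
    rw [hval]
    have hmem : (((List.finRange (3 * d + 1)).map fun (s : Fin (3 * d + 1)) => (β t s, a s)),
        [(β (t + 1) (⟨J, by omega⟩ : Fin (2 * d + 1)), topF d a ⟨J, by omega⟩)]) ∈
        topClauses M n P T t :=
      List.mem_flatMap.2 ⟨a, mem_allTuples M a, List.mem_map.2 ⟨⟨J, by omega⟩, List.mem_finRange _, rfl⟩⟩
    obtain ⟨w, hw, hwt⟩ := hτ _ (mem_clauses_top x P T ht hmem) (by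
      intro v hv
      obtain ⟨s, -, rfl⟩ := List.mem_map.1 hv
      exact (dec_spec hτ ht.le (by have := s.2; omega) _).2 (hrow s (by have := s.2; omega)))
    simp only [List.mem_singleton] at hw
    subst hw
    exact hwt
  by_cases hJint : J ≤ SS - d
  · -- interior rule
    obtain ⟨j, hj, rfl⟩ : ∃ j, j < NN n P + d * T ∧ J = 2 * d + 1 + j :=
      ⟨J - (2 * d + 1), by rw [NN_eq]; omega, by omega⟩
    let h : Fin (d + 1) → Val M.tm := fun s => absVal (cfgAt M x u t) s
    let nb : Fin (2 * d + 1) → Val M.tm := fun s => absVal (cfgAt M x u t) (2 * d + 1 + j - d + s)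
    have hval := absVal_stepTotal_int hd (cfgAt M x u t) hgood (2 * d + 1 + j) (by omega)
    rw [hval]
    have hmem : ((((List.finRange (d + 1)).map fun (s : Fin (d + 1)) => (β t s, h s)) ++
        ((List.finRange (2 * d + 1)).map fun (s : Fin (2 * d + 1)) => (β t (d + 1 + j + s), nb s))),
        [(β (t + 1) (2 * d + 1 + j), intF d h nb)]) ∈ intClauses M n P T t j :=
      List.mem_flatMap.2 ⟨h, mem_allTuples M h, List.mem_map.2 ⟨nb, mem_allTuples M nb, rfl⟩⟩
    obtain ⟨w, hw, hwt⟩ := hτ _ (mem_clauses_int x P T ht hj hmem) (by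
      intro v hv
      rcases List.mem_append.1 hv with hv | hv
      · obtain ⟨s, -, rfl⟩ := List.mem_map.1 hv
        exact (dec_spec hτ ht.le (by have := s.2; omega) _).2 (hrow s (by have := s.2; omega))
      · obtain ⟨s, -, rfl⟩ := List.mem_map.1 hv
        refine (dec_spec hτ ht.le (by have := s.2; omega) _).2 ?_
        rw [hrow _ (by have := s.2; omega)]
        simp only [nb]
        congr 1; omega)
    simp only [List.mem_singleton] at hw
    subst hw
    exact hwt
  · -- bottom: empty by the height bound
    obtain ⟨r, hr, rfl⟩ : ∃ r, r < d ∧ J = NN n P + d * T + 2 * d + 1 + r :=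
      ⟨J - (NN n P + d * T + 2 * d + 1), by rw [NN_eq] at *; omega, by rw [NN_eq] at *; omega⟩
    have hlen : ∀ k, ((TM2Sim.stepTotal M.tm (cfgAt M x u t)).stk k).length + 1 ≤
        NN n P + d * T + 2 * d + 1 + r := by
      intro k
      rw [← cfgAt_succ]
      have h1 := length_cfgAt_le (M := M) x u (t + 1) k
      have h2 : TM2Sim.depth M.tm * (t + 1) ≤ d * T :=
        (Nat.mul_le_mul hd (Nat.succ_le_of_lt ht))
      rw [NN_eq]; omega
    rw [absVal_eq_noneVal hlen]
    have hmem : ([], [(β (t + 1) (NN n P + d * T + 2 * d + 1 + r), noneVal M.tm)]) ∈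
        botClauses M n P T t := List.mem_map.2 ⟨r, List.mem_range.2 hr, rfl⟩
    exact true_of_unit hτ (mem_clauses_bot x P T ht hmem)

/-- **Decoding all rows**: some certificate `u`, `|u| ≤ P`, has every decoded row `t ≤ T` as the
row of configuration `t` of its run. [cite: Sipser2012, Thm. 7.37 (proof)] -/
theorem dec_all : ∃ u : List Bool, u.length ≤ P ∧
    ∀ t ≤ T, ∀ J ≤ SS, dec τ x P T t J = absVal (cfgAt M x u t) J := by
  obtain ⟨u, hu, h0⟩ := dec_zero hτ
  refine ⟨u, hu, fun t => ?_⟩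
  induction t with
  | zero => exact fun _ => h0
  | succ t ih => exact fun ht => dec_succ hτ hu (Nat.lt_of_succ_le ht) (ih (by omega))

/-- **Soundness of the tableau**: if every run on a certificate of length `≤ P` halts within `T`
steps with output `[f w]`, a satisfying assignment yields a certificate with `f w = true`
(Sipser 2012, proof of Thm. 7.37, `φ_accept` and determinism). [cite: Sipser2012, Thm. 7.37 (proof)] -/
theorem sound {f : List Bool → Bool}
    (hrun : ∀ u : List Bool, u.length ≤ P → M.OutputsWithin (boolPair x u) [f (boolPair x u)] T) :
    ∃ u : List Bool, u.length ≤ P ∧ f (boolPair x u) = true := by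
  obtain ⟨u, hu, hdec⟩ := dec_all hτ
  refine ⟨u, hu, ?_⟩
  have hS : SS = 2 * n + 2 + P + d * T + 3 * d := rfl
  have hd1 : 1 ≤ d := by have := depth_lt_dM M; omega
  have h1 : (1 : ℕ) ≤ SS := by omega
  have hacc := (dec_spec hτ le_rfl h1 _).1 (true_of_unit hτ (mem_clauses_acc x P T))
  rw [hdec T le_rfl 1 h1, cfgAt_eq_haltList (hrun u hu), absVal_haltList_one] at hacc
  have hgood : TM2Sim.Good M.tm (cfgAt M x u T) := good_cfgAt x u T
  rw [cfgAt_eq_haltList (hrun u hu), TM2Comp.haltList_eq] at hgood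
  have hsym : TM2Sim.IsSym M.tm M.tm.k₁ (M.outputAlphabet.symm (f (boolPair x u))) :=
    hgood M.tm.k₁ _ (by simp)
  simp only [accVal, List.getElem?_cons_zero, Prod.mk.injEq, true_and] at hacc
  have := outCell_some_inj hsym hacc
  exact M.outputAlphabet.symm.injective this

end Sound

/-! ### Completeness: the rows of an accepting run satisfy the clauses -/

section Complete

variable {x : List Bool} {P T : ℕ} (u : List Bool)

local notation "n" => x.length
local notation "d" => dM M
local notation "β" => blk M (List.length x) P T
local notation "SS" => S1 M (List.length x) P T

/-- The intended assignment: block `b` holds the value of block `b mod RB` of row `b / RB` of the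
run on `u`. [cite: Sipser2012, Thm. 7.37 (proof)] -/
noncomputable def intended (x : List Bool) (P T : ℕ) (u : List Bool) : TVar M → Bool :=
  by classical exact fun bv => decide (bv.2 =
    absVal (cfgAt M x u (bv.1 / RB M x.length P T)) (bv.1 % RB M x.length P T))

/-- The intended assignment on the tableau. [folklore] -/
theorem intended_blk {t J : ℕ} (hJ : J ≤ SS) (v : Val M.tm) :
    intended (M := M) x P T u (β t J, v) = true ↔ v = absVal (cfgAt M x u t) J := by
  classical
  unfold intended
  simp only [blk_div M n P T hJ, blk_mod M n P T hJ, decide_eq_true_eq]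

variable {u}

/-- **Completeness of the tableau**: the rows of an accepting run within time `T` on a
certificate of length `≤ P` satisfy every clause. [cite: Sipser2012, Thm. 7.37 (proof)] -/
theorem complete {f : List Bool → Bool} (hu : u.length ≤ P)
    (hrun : M.OutputsWithin (boolPair x u) [f (boolPair x u)] T) (hf : f (boolPair x u) = true) :
    ∀ cl ∈ clauses M P T x, HClause.Holds (intended (M := M) x P T u) cl := by
  classical
  have hS : SS = 2 * n + 2 + P + d * T + 3 * d := rfl
  have hd : TM2Sim.depth M.tm ≤ d := (depth_lt_dM M).le
  have hd1 : 1 ≤ d := by have := depth_lt_dM M; omega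
  have hN : NN n P = 2 * n + 2 + P := rfl
  -- a unit clause on the tableau holds iff the value is right
  have unit : ∀ {t J : ℕ} (v : Val M.tm), J ≤ SS → absVal (cfgAt M x u t) J = v →
      HClause.Holds (intended (M := M) x P T u) ([], [(β t J, v)]) := fun v hJ hv =>
    (HClause.holds_unit _ _).2 ((intended_blk u hJ v).2 hv.symm)
  intro cl hcl
  unfold clauses xClauses nClauses at hcl
  simp only [List.mem_append, List.mem_flatMap, List.mem_range, List.mem_cons,
    List.mem_nil_iff, or_false] at hcl
  rcases hcl with ⟨⟨b, i⟩, hbi, hcl⟩ | (((hcl | ⟨t, ht, hcl⟩) | ⟨t, ht, J, hJ, hcl⟩) | rfl)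
  · -- bits of `x`
    have hb : x[i]? = some b := List.mk_mem_zipIdx_iff_getElem?.1 hbi
    have hi : i < n := by
      by_contra hle; rw [List.getElem?_eq_none (by omega)] at hb; cases hb
    obtain ⟨h1, h2⟩ := absVal_cfgAt_zero_bit (M := M) u hb
    simp only [bitClauses, List.mem_cons, List.mem_nil_iff, or_false] at hcl
    rcases hcl with rfl | rfl
    · exact unit _ (by omega) h1
    · exact unit _ (by omega) h2
  · -- start row
    simp only [startClauses, List.mem_append, List.mem_cons, List.mem_nil_iff, or_false,
      List.mem_flatMap, List.mem_range, List.mem_map] at hcl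
    rcases hcl with ((rfl | rfl | rfl) | ⟨j, hj, hcl⟩) | ⟨j, hj, rfl⟩
    · exact unit _ (by omega) (absVal_cfgAt_zero_zero x u)
    · exact unit _ (by omega) (absVal_cfgAt_zero_sep x u).1
    · exact unit _ (by omega) (absVal_cfgAt_zero_sep x u).2
    · rcases hcl with rfl | rfl
      · -- a certificate block holds an input symbol or is empty
        intro _
        rcases absVal_cfgAt_zero_cert_cases (M := M) x u j with ⟨b, -, hb⟩ | ⟨-, hnone⟩
        · cases b
          · exact ⟨_, by simp, (intended_blk u (by omega) _).2 hb.symm⟩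
          · exact ⟨_, by simp, (intended_blk u (by omega) _).2 hb.symm⟩
        · exact ⟨_, by simp, (intended_blk u (by omega) _).2 hnone.symm⟩
      · -- once empty, empty
        intro hpre
        have h1 := hpre _ (List.mem_singleton.2 rfl)
        rw [intended_blk u (by omega)] at h1
        rcases absVal_cfgAt_zero_cert_cases (M := M) x u j with ⟨b, -, hb⟩ | ⟨hlen, -⟩
        · exact absurd (h1.trans hb).symm (symVal_ne_noneVal b)
        · refine ⟨_, List.mem_singleton.2 rfl, (intended_blk u (by omega) _).2 ?_⟩
          rcases absVal_cfgAt_zero_cert_cases (M := M) x u (j + 1) with ⟨b, hb, -⟩ | ⟨-, h'⟩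
          · have : j + 1 < u.length := by
              by_contra hle; rw [List.getElem?_eq_none (by omega)] at hb; cases hb
            omega
          · rw [show 2 * n + 4 + j = 2 * n + 3 + (j + 1) by omega, h']
    · -- the empty tail
      refine unit _ (by omega) ?_
      rcases absVal_cfgAt_zero_cert_cases (M := M) x u (P + j) with ⟨b, hb, -⟩ | ⟨-, h'⟩
      · have : P + j < u.length := by
          by_contra hle; rw [List.getElem?_eq_none (by omega)] at hb; cases hb
        omega
      · rw [hN, show 2 * n + 2 + P + 1 + j = 2 * n + 3 + (P + j) by omega, h']
  · -- move clauses of row `t < T`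
    have hgood := good_cfgAt (M := M) x u t
    simp only [topClauses, intClauses, botClauses, List.mem_flatMap,
      List.mem_map, List.mem_range] at hcl
    rcases hcl with (⟨a, -, r, -, rfl⟩ | ⟨j, hj, h, -, nb, -, rfl⟩) | ⟨r, hr, rfl⟩
    · -- top
      intro hpre
      have ha : a = fun (s : Fin (3 * d + 1)) => absVal (cfgAt M x u t) s := by
        funext s
        exact (intended_blk u (by have := s.2; omega) _).1
          (hpre _ (List.mem_map.2 ⟨s, List.mem_finRange _, rfl⟩))
      refine ⟨_, List.mem_singleton.2 rfl, (intended_blk u (by have := r.2; omega) _).2 ?_⟩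
      rw [ha, cfgAt_succ, absVal_stepTotal_top hd _ hgood r]
    · -- interior
      intro hpre
      have hh : h = fun (s : Fin (d + 1)) => absVal (cfgAt M x u t) s := by
        funext s
        exact (intended_blk u (by have := s.2; omega) _).1
          (hpre _ (List.mem_append_left _ (List.mem_map.2 ⟨s, List.mem_finRange _, rfl⟩)))
      have hnb : nb = fun (s : Fin (2 * d + 1)) => absVal (cfgAt M x u t) (2 * d + 1 + j - d + s) := by
        funext s
        have := (intended_blk u (by have := s.2; omega) _).1
          (hpre _ (List.mem_append_right _ (List.mem_map.2 ⟨s, List.mem_finRange _, rfl⟩)))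
        rw [this]; congr 1; omega
      refine ⟨_, List.mem_singleton.2 rfl, (intended_blk u (by omega) _).2 ?_⟩
      rw [hh, hnb, cfgAt_succ, absVal_stepTotal_int hd _ hgood (2 * d + 1 + j) (by omega)]
    · -- bottom
      refine unit _ (by rw [hN]; omega) ?_
      refine absVal_eq_noneVal fun k => ?_
      have h1 := length_cfgAt_le (M := M) x u (t + 1) k
      have h2 : TM2Sim.depth M.tm * (t + 1) ≤ d * T := Nat.mul_le_mul hd (Nat.succ_le_of_lt ht)
      rw [hN]; omega
  · -- exactly-one clauses
    simp only [cellClauses, List.mem_cons, List.mem_flatMap] at hcl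
    rcases hcl with rfl | ⟨v, -, v', -, hcl⟩
    · intro _
      exact ⟨_, List.mem_map.2 ⟨_, mem_allVals M _, rfl⟩, (intended_blk u (by omega) _).2 rfl⟩
    · by_cases hvv : v = v'
      · rw [if_pos hvv] at hcl; simp at hcl
      · rw [if_neg hvv] at hcl
        simp only [List.mem_singleton] at hcl
        subst hcl
        intro hpre
        have h1 := (intended_blk u (by omega) v).1 (hpre (β t J, v) (by simp))
        have h2 := (intended_blk u (by omega) v').1 (hpre (β t J, v') (by simp))
        exact absurd (h1.trans h2.symm) hvv
  · -- accept
    refine unit _ (by omega) ?_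
    rw [cfgAt_eq_haltList hrun, absVal_haltList_one, hf]
    rfl

end Complete

/-! ### The equivalence -/

/-- **Correctness of the Cook–Levin tableau formula.** If `M` halts within `T` steps with output
`[f w]` on every `w = boolPair x u` with `|u| ≤ P`, then the tableau formula is satisfiable iff
some certificate `u`, `|u| ≤ P`, has `f (boolPair x u) = true` (Cook 1971, Thm. 1; Sipser 2012,
Thm. 7.37; Arora–Barak 2009, Lemma 2.11). [cite: Cook1971, Thm. 1] [cite: Sipser2012, Thm. 7.37] -/
theorem satisfiable_tableau_iff (x : List Bool) (P T : ℕ) {f : List Bool → Bool}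
    (hrun : ∀ u : List Bool, u.length ≤ P → M.OutputsWithin (boolPair x u) [f (boolPair x u)] T) :
    (tableau M P T x).Satisfiable ↔ ∃ u : List Bool, u.length ≤ P ∧ f (boolPair x u) = true := by
  constructor
  · rintro ⟨τ, hτ⟩
    exact sound (M := M) ((HClause.eval_ofCNF_cnfOf τ _).1 hτ) hrun
  · rintro ⟨u, hu, hf⟩
    exact ⟨intended (M := M) x P T u, (HClause.eval_ofCNF_cnfOf _ _).2 (complete hu (hrun u hu) hf)⟩

/-- **Correctness of the Cook–Levin CNF** (the same statement for `CNF.Satisfiable` of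
`tableauCNF`, the form feeding `SAT`). [cite: Cook1971, Thm. 1] [cite: Sipser2012, Thm. 7.37] -/
theorem satisfiable_tableauCNF_iff (x : List Bool) (P T : ℕ) {f : List Bool → Bool}
    (hrun : ∀ u : List Bool, u.length ≤ P → M.OutputsWithin (boolPair x u) [f (boolPair x u)] T) :
    (tableauCNF M P T x).Satisfiable ↔ ∃ u : List Bool, u.length ≤ P ∧ f (boolPair x u) = true := by
  rw [← satisfiable_tableau_iff x P T hrun]
  unfold tableau PropForm.Satisfiable CNF.Satisfiable
  simp only [PropForm.eval_ofCNF]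

end Tableau

end Literature.Computability.Complexity
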